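import Mathlib
import Summits.Ventures.HodgeRepro.Tier4.Line4.TailLayerCakeFibre
import Summits.Ventures.HodgeRepro.Tier4.Line4.FibreDominatedOfTail

/-!
# Tier4/Line4/LevelTail — C-L4-LEVELTAIL: the tail of the geometric side in the LEVEL-MEASURE form — every rational
point off the fibre on its own `(t, t′)`-support, the level measure cancelling against the main term

Blind re-derivation cell `pub-hodge-repro`, Tier 4 «PROVE THE STEP», LINE L4, seat t4-x2 (g4, reserve wall-breaker),
lead (R-30) S15136 on crit-1 g9's objection O-L4-FIBRE-SCALE (Entry 129, S15135): on a level family whose finite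
supports shrink (`K(q^n)`), a SUP-NORM decay constant uniform in the level and a level-free lower bound of the main
term are jointly unsatisfiable — the main term lives on a `(t, t′)`-set of measure `≲ levelNorm N → 0`, while the
sup-norm layer-cake (TailLayerCake §4 / TailLayerCakeFibre §2 / FibreDominatedOfTail — SUPPORT for the `O(1)`-sup
normalisation only, from this line on) charges every off-fibre term the FULL torus measure.  THIS MODULE keeps the
`(t, t′)`-support of every rational point: the tail of `J` is the SUM over the rational points off the fibre of the
`(t, t′)`-integrals of the single terms (§1, in `ENNReal`, no summability side condition), each term is bounded on its
own level support `A_N(γ)` (§2), and the assembly (§3) bounds the tail by `v N · (threshold layer-cake)` against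
`m · v N` from the main term — the level measure `v N` cancels, the margin `β − α` is spent once.  Tree path
`lean/Summits/Ventures/HodgeRepro/Tier4/Line4/LevelTail.lean`.  0 print, no `def`.

* `enorm_J_sub_sum_le_tsum_lintegral` — `‖J(f) − ∑_{o ∈ E} O_o(f)‖ₑ ≤ ∑'_{γ : orbitOf γ ∉ E} ∫⁻_{D_T × D_{T′}} ‖f(t⁻¹ γ t′)‖ₑ`
  (the two `integral_sub`s on KernelL1's integrability, `enorm_integral_le_lintegral_enorm`, `lintegral_prod` on the
  restricted finite measures, `‖∑'‖ₑ ≤ ∑' ‖·‖ₑ`, `lintegral_tsum`).  NO per-orbit term count enters.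
* `lintegral_norm_le_of_support` — one term on its level support `A`: `∫⁻_{D} ‖f(t⁻¹ γ t′)‖ₑ ≤ c · (μ_T ⊗ μ_{T′})(A)`.
* `exists_fibreDominated_of_level_decay_count` — THE LEVEL-MEASURE ASSEMBLY: from the decay at the rational point
  `‖f N (t⁻¹ γ t′)‖ ≤ C e^{−β d γ}` on `D_T × D_{T′}`, the level supports `A N γ` of measure `≤ v N` (C-L4-SUPPMEAS),
  the count of rate `α < β` on the `N`-free region `Q` of the relevant rational points (`SublevelCount`), the
  threshold `g N → ∞` off the fibre `E` (the coset sparsity off the fibre), and the main term `m · v N ≤ ‖∑_{o ∈ E}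
  O_o(f N)‖` (the unit of record below): the fibre sum dominates the remainder from some level on
  (`FibreDominatedFrom` unfolded), and `J(f N) ≠ 0` (`exists_J_ne_zero_of_level_decay_count`).

NORMALISATION OF RECORD (lead (R-32) S15152, crit-1 S15161): the UNIT is `suppMeasure N γ₀ = (μ_T ⊗ μ_{T′})(A_N γ₀)`
(L2-p1's SuppMeasure), NOT `levelNorm N`; `v N := c · suppMeasure N γ₀` through the RATIO display
`suppMeasure N γ ≤ c · suppMeasure N γ₀` OFF THE TRANSPORTER — so every tail-side binder (`hdecay`, `hsuppA`, `hAv`,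
`hQ`) is asked on the rational points OFF the fibre `E` only (the transporter orbits sit inside `E` when the tori are
conjugate, (R-31)(iii)); `hdecay` is the sup bound of the family at the rational point for the family rescaled to sup
`O(1)` (the shift `d(t⁻¹ γ t′) ≥ d γ − c` on the compact closures absorbed in `C`); `hmain` is L2-p1's
`main ≥ δ · suppMeasure N γ₀` in the same rescaling.  The statement is homogeneous: rescaling the family rescales `C`
and `m` alike.  Nothing here says anything about the status of the Hodge conjecture for CM abelian varieties, which is NOT
proved (HC_CM is NOT proved by anyone in this repository).
-/

set_option autoImplicit false

noncomputable section

namespace Summit.Ventures.HodgeRepro.Tier4.Line4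

open MeasureTheory Topology Filter Summit.Ventures.HodgeRepro.Tier4.Common
  Summit.Ventures.HodgeRepro.Tier4.Line1 Summit.Ventures.HodgeRepro.Tier4.Line1.RTF

open scoped ENNReal

variable {G : Type} [Group G] [TopologicalSpace G] [IsTopologicalGroup G] [MeasurableSpace G] [BorelSpace G]
  (S : Setting G) [SecondCountableTopology G]

/-! ## 1. The tail of `J` as the sum over the rational points of their `(t, t′)`-integrals -/

omit [BorelSpace G] [SecondCountableTopology G] in
/-- The map `(t, t′) ↦ t⁻¹ γ t′` on `T × T′` is continuous. -/
theorem continuous_conj_pair (γ : G) : Continuous fun p : S.T × S.T' => (p.1 : G)⁻¹ * γ * (p.2 : G) :=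
  ((continuous_subtype_val.comp continuous_fst).inv.mul continuous_const).mul
    (continuous_subtype_val.comp continuous_snd)

/-- **The tail of the geometric side, point by point**: `‖J(f) − ∑_{o ∈ E} O_o(f)‖ₑ ≤ ∑'_{γ : orbitOf γ ∉ E}
∫⁻_{D_T × D_{T′}} ‖f(t⁻¹ γ t′)‖ₑ` for a continuous `f` with the uniform Poincaré bound and characters of modulus one.
No summability is assumed on the right (an `ℝ≥0∞`-valued sum of `ℝ≥0∞`-valued integrals). -/
theorem enorm_J_sub_sum_le_tsum_lintegral {f : G → ℂ} (hf : Continuous f) (hP : L1Class.PoincareSummable S f)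
    {χ : S.T → ℂ} (hχ : S.IsCharacter χ) {χ' : S.T' → ℂ} (hχ' : S.IsCharacter' χ') (E : Finset S.Orbit) :
    ‖S.J χ χ' f - ∑ o ∈ E, S.orbital χ χ' o f‖ₑ ≤
      ∑' γ : {γ : S.Gk // S.orbitOf γ ∈ (E : Set S.Orbit)ᶜ},
        ∫⁻ p, ‖f ((p.1 : G)⁻¹ * γ.1 * (p.2 : G))‖ₑ ∂((S.μT.restrict S.DT).prod (S.μT'.restrict S.DT')) := by
  haveI : Countable S.Gk := countable_Gk S
  haveI : IsFiniteMeasure (S.μT'.restrict S.DT') := isFiniteMeasure_restrict.mpr (measure_DT'_lt_top S).ne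
  haveI : SecondCountableTopology S.T := Topology.IsEmbedding.subtypeVal.secondCountableTopology
  haveI : SecondCountableTopology S.T' := Topology.IsEmbedding.subtypeVal.secondCountableTopology
  have hs : ∀ x y : G, Summable (fun γ : S.Gk => ‖f (x⁻¹ * γ * y)‖) := summable_norm_of_poincareUniform S hP
  have hu : ∀ a, ‖χ a‖ = 1 := hχ.unit
  have hu' : ∀ a, ‖χ' a‖ = 1 := hχ'.unit
  have hχc : Continuous χ := hχ.cont
  have hχ'c : Continuous χ' := hχ'.cont
  -- the joint measurability of `K_f − ∑_{o ∈ E} K_f^o` on `T × T′`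
  have hsumM : StronglyMeasurable fun p : S.T × S.T' => ∑ o ∈ E, S.partialKernel o f p.1 p.2 := by
    have h := Finset.stronglyMeasurable_sum E
      (f := fun o => fun p : S.T × S.T' => S.partialKernel o f p.1 p.2)
      (fun o _ => stronglyMeasurable_partialKernel_torus S hf hs o)
    convert h using 1
    funext p
    simp [Finset.sum_apply]
  have hG : Measurable fun p : S.T × S.T' =>
      ‖S.kernel f p.1 p.2 - ∑ o ∈ E, S.partialKernel o f p.1 p.2‖ₑ :=
    ((stronglyMeasurable_kernel_torus S hf hs).sub hsumM).enorm
  -- step 1: `J − ∑_E O = ∫_{D_T} (F₁ − F₂)`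
  have hintO : ∀ o ∈ E, IntegrableOn
      (fun t : S.T => ∫ t' in S.DT', S.partialKernel o f t t' * χ t * starRingEnd ℂ (χ' t') ∂S.μT') S.DT S.μT :=
    fun o _ => integrableOn_integral_partialKernel_mul_DT S hf hP o hχc hu hχ'c hu'
  have hsub := integral_sub (integrableOn_integral_kernel_mul_DT S hf hP hχc hu hχ'c hu')
    (integrable_finsetSum E hintO)
  change ‖(∫ t in S.DT, ∫ t' in S.DT', S.kernel f t t' * χ t * starRingEnd ℂ (χ' t') ∂S.μT' ∂S.μT) -
    ∑ o ∈ E, ∫ t in S.DT, ∫ t' in S.DT', S.partialKernel o f t t' * χ t * starRingEnd ℂ (χ' t') ∂S.μT' ∂S.μT‖ₑ ≤ _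
  rw [← integral_finsetSum E hintO, ← hsub]
  -- step 2: the outer integral
  refine (enorm_integral_le_lintegral_enorm _).trans ?_
  -- step 3: for `t ∈ D_T`, the inner integral
  have hinner : ∀ t ∈ S.DT,
      ‖(∫ t' in S.DT', S.kernel f t t' * χ t * starRingEnd ℂ (χ' t') ∂S.μT') -
        ∑ o ∈ E, ∫ t' in S.DT', S.partialKernel o f t t' * χ t * starRingEnd ℂ (χ' t') ∂S.μT'‖ₑ ≤
        ∫⁻ t' in S.DT', ‖S.kernel f t t' - ∑ o ∈ E, S.partialKernel o f t t'‖ₑ ∂S.μT' := by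
    intro t ht
    have ht' : t ∈ closure S.DT := subset_closure ht
    have hint : ∀ o ∈ E, IntegrableOn
        (fun t' : S.T' => S.partialKernel o f t t' * χ t * starRingEnd ℂ (χ' t')) S.DT' S.μT' :=
      fun o _ => integrableOn_partialKernel_mul_DT' S hf hP o χ hχ'c hu' ht'
    rw [← integral_finsetSum E hint,
      ← integral_sub (integrableOn_kernel_mul_DT' S hf hP χ hχ'c hu' ht') (integrable_finsetSum E hint)]
    refine (enorm_integral_le_lintegral_enorm _).trans (le_of_eq ?_)
    refine lintegral_congr fun t' => ?_
    have heq : S.kernel f t t' * χ t * starRingEnd ℂ (χ' t') -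
        ∑ o ∈ E, S.partialKernel o f t t' * χ t * starRingEnd ℂ (χ' t') =
        (S.kernel f t t' - ∑ o ∈ E, S.partialKernel o f t t') * χ t * starRingEnd ℂ (χ' t') := by
      rw [sub_mul, sub_mul, Finset.sum_mul, Finset.sum_mul]
    have h1 : ‖χ t‖ₑ = 1 := by rw [← ofReal_norm, hu t, ENNReal.ofReal_one]
    have h2 : ‖starRingEnd ℂ (χ' t')‖ₑ = 1 := by rw [← ofReal_norm, Complex.norm_conj, hu' t', ENNReal.ofReal_one]
    rw [heq, enorm_mul, enorm_mul, h1, h2, mul_one, mul_one]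
  refine (lintegral_mono_ae ((ae_restrict_iff'₀ S.fdT.nullMeasurableSet).2
    (Eventually.of_forall fun t ht => hinner t ht))).trans ?_
  -- step 4: the iterated integral as a product integral
  rw [← lintegral_prod _ hG.aemeasurable]
  -- step 5: pointwise, the kernel difference is the tail sum
  refine (lintegral_mono fun p => ?_).trans (le_of_eq (lintegral_tsum fun γ => ?_))
  · rw [kernel_sub_sum_partialKernel_eq_tsum S (hs _ _) E]
    have hsum : Summable fun γ : ({γ : S.Gk | S.orbitOf γ ∈ E}ᶜ : Set S.Gk) =>
        ‖f ((p.1 : G)⁻¹ * γ.1 * (p.2 : G))‖ := (hs _ _).subtype _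
    calc ‖∑' γ : ({γ : S.Gk | S.orbitOf γ ∈ E}ᶜ : Set S.Gk), f ((p.1 : G)⁻¹ * γ.1 * (p.2 : G))‖ₑ
        = ENNReal.ofReal ‖∑' γ : ({γ : S.Gk | S.orbitOf γ ∈ E}ᶜ : Set S.Gk), f ((p.1 : G)⁻¹ * γ.1 * (p.2 : G))‖ :=
          (ofReal_norm _).symm
      _ ≤ ENNReal.ofReal (∑' γ : ({γ : S.Gk | S.orbitOf γ ∈ E}ᶜ : Set S.Gk), ‖f ((p.1 : G)⁻¹ * γ.1 * (p.2 : G))‖) :=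
          ENNReal.ofReal_le_ofReal (norm_tsum_le_tsum_norm hsum)
      _ = ∑' γ : ({γ : S.Gk | S.orbitOf γ ∈ E}ᶜ : Set S.Gk), ENNReal.ofReal ‖f ((p.1 : G)⁻¹ * γ.1 * (p.2 : G))‖ :=
          ENNReal.ofReal_tsum_of_nonneg (fun _ => norm_nonneg _) hsum
      _ = ∑' γ : {γ : S.Gk // S.orbitOf γ ∈ (E : Set S.Orbit)ᶜ}, ‖f ((p.1 : G)⁻¹ * γ.1 * (p.2 : G))‖ₑ := by
          refine tsum_congr fun γ => ofReal_norm _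
  · exact ((hf.comp (continuous_conj_pair S γ.1)).measurable.enorm).aemeasurable

/-! ## 2. One term on its level support -/

omit [IsTopologicalGroup G] [BorelSpace G] [SecondCountableTopology G] in
/-- **One rational point on its own `(t, t′)`-support**: if `f(t⁻¹ γ t′)` vanishes off a measurable `A ⊆ T × T′` on
`D_T × D_{T′}` and is bounded by `c` there, its `(t, t′)`-integral is `≤ c · (μ_T|_{D_T} ⊗ μ_{T′}|_{D_{T′}})(A)`. -/
theorem lintegral_norm_le_of_support (f : G → ℂ) (γ : G) {A : Set (S.T × S.T')} (hA : MeasurableSet A)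
    (hsupp : ∀ t ∈ S.DT, ∀ t' ∈ S.DT', f ((t : G)⁻¹ * γ * (t' : G)) ≠ 0 → (t, t') ∈ A) {c : ℝ}
    (hle : ∀ t ∈ S.DT, ∀ t' ∈ S.DT', ‖f ((t : G)⁻¹ * γ * (t' : G))‖ ≤ c) :
    ∫⁻ p, ‖f ((p.1 : G)⁻¹ * γ * (p.2 : G))‖ₑ ∂((S.μT.restrict S.DT).prod (S.μT'.restrict S.DT')) ≤
      ENNReal.ofReal c * ((S.μT.restrict S.DT).prod (S.μT'.restrict S.DT')) A := by
  haveI : IsFiniteMeasure (S.μT'.restrict S.DT') := isFiniteMeasure_restrict.mpr (measure_DT'_lt_top S).ne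
  -- almost every point of the product of the restricted measures lies in `D_T × D_{T′}`
  have hae₁ : ∀ᵐ p ∂((S.μT.restrict S.DT).prod (S.μT'.restrict S.DT')), p.1 ∈ S.DT := by
    rw [ae_iff]
    have h : {p : S.T × S.T' | ¬ p.1 ∈ S.DT} = S.DTᶜ ×ˢ Set.univ := by
      ext p
      simp
    rw [h, Measure.prod_prod, Measure.restrict_apply₀' S.fdT.nullMeasurableSet, Set.compl_inter_self,
      measure_empty, zero_mul]
  have hae₂ : ∀ᵐ p ∂((S.μT.restrict S.DT).prod (S.μT'.restrict S.DT')), p.2 ∈ S.DT' := by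
    rw [ae_iff]
    have h : {p : S.T × S.T' | ¬ p.2 ∈ S.DT'} = Set.univ ×ˢ S.DT'ᶜ := by
      ext p
      simp
    rw [h, Measure.prod_prod, Measure.restrict_apply₀' S.fdT'.nullMeasurableSet, Set.compl_inter_self,
      measure_empty, mul_zero]
  calc ∫⁻ p, ‖f ((p.1 : G)⁻¹ * γ * (p.2 : G))‖ₑ ∂((S.μT.restrict S.DT).prod (S.μT'.restrict S.DT'))
      ≤ ∫⁻ p, A.indicator (fun _ => ENNReal.ofReal c) p ∂((S.μT.restrict S.DT).prod (S.μT'.restrict S.DT')) := by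
        refine lintegral_mono_ae ((hae₁.and hae₂).mono fun p hp => ?_)
        by_cases h0 : f ((p.1 : G)⁻¹ * γ * (p.2 : G)) = 0
        · rw [h0, enorm_zero]
          exact zero_le
        · rw [Set.indicator_of_mem (hsupp p.1 hp.1 p.2 hp.2 h0), ← ofReal_norm]
          exact ENNReal.ofReal_le_ofReal (hle p.1 hp.1 p.2 hp.2)
    _ = ENNReal.ofReal c * ((S.μT.restrict S.DT).prod (S.μT'.restrict S.DT')) A := lintegral_indicator_const hA _

/-! ## 3. The level-measure assembly -/

/-- **The tail of `J` in the level-measure form, one level**: for a continuous `f` with the uniform Poincaré bound,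
the decay `‖f(t⁻¹ γ t′)‖ ≤ C e^{−β d γ}` on `D_T × D_{T′}` at every rational point `γ`, the level supports `A γ`
(`f(t⁻¹ γ t′) ≠ 0 → (t, t′) ∈ A γ`) of product measure `≤ v`, the count of rate `α < β` on a region `Q` containing
every relevant rational point, and the threshold `R ≤ d γ` on the relevant points off the fibre `E`:
`‖J(f) − ∑_{o ∈ E} O_o(f)‖ ≤ v · C · C′ e^α e^{−(β−α) R} (1 − e^{α−β})⁻¹`. -/
theorem norm_J_sub_sum_le_level {f : G → ℂ} (hf : Continuous f) (hP : L1Class.PoincareSummable S f)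
    (d : S.Gk → ℝ) {C α β C' R v : ℝ} (hC : 0 ≤ C) (hαβ : α < β) (hβ : 0 ≤ β) (hC' : 0 ≤ C') (hv : 0 ≤ v)
    {χ : S.T → ℂ} (hχ : S.IsCharacter χ) {χ' : S.T' → ℂ} (hχ' : S.IsCharacter' χ') (E : Finset S.Orbit)
    (hdecay : ∀ γ : S.Gk, S.orbitOf γ ∉ E → ∀ t ∈ S.DT, ∀ t' ∈ S.DT',
      ‖f ((t : G)⁻¹ * γ * (t' : G))‖ ≤ C * Real.exp (-(β * d γ)))
    (A : S.Gk → Set (S.T × S.T')) (hAmeas : ∀ γ, S.orbitOf γ ∉ E → MeasurableSet (A γ))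
    (hsuppA : ∀ γ : S.Gk, S.orbitOf γ ∉ E → ∀ t ∈ S.DT, ∀ t' ∈ S.DT',
      f ((t : G)⁻¹ * γ * (t' : G)) ≠ 0 → (t, t') ∈ A γ)
    (hAv : ∀ γ, S.orbitOf γ ∉ E → ((S.μT.restrict S.DT).prod (S.μT'.restrict S.DT')) (A γ) ≤ ENNReal.ofReal v)
    (Q : S.Gk → Prop)
    (hQ : ∀ γ : S.Gk, S.orbitOf γ ∉ E → (∃ t ∈ S.DT, ∃ t' ∈ S.DT', f ((t : G)⁻¹ * γ * (t' : G)) ≠ 0) → Q γ)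
    (hcount : ∀ T : ℝ, ∃ s : Finset S.Gk, (∀ γ, Q γ → d γ ≤ T → γ ∈ s) ∧ (s.card : ℝ) ≤ C' * Real.exp (α * T))
    (hR : ∀ γ : S.Gk, S.orbitOf γ ∉ E → (∃ t ∈ S.DT, ∃ t' ∈ S.DT', f ((t : G)⁻¹ * γ * (t' : G)) ≠ 0) → R ≤ d γ) :
    ‖S.J χ χ' f - ∑ o ∈ E, S.orbital χ χ' o f‖ ≤
      v * (C * (C' * Real.exp α * Real.exp (-((β - α) * R)) * (1 - Real.exp (α - β))⁻¹)) := by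
  classical
  -- the weight of a rational point: `C e^{−β d γ} v` if it is relevant, `0` otherwise
  obtain ⟨w, hw⟩ : ∃ w : S.Gk → ℝ, ∀ γ, w γ =
      if (∃ t ∈ S.DT, ∃ t' ∈ S.DT', f ((t : G)⁻¹ * γ * (t' : G)) ≠ 0) then C * Real.exp (-(β * d γ)) * v else 0 :=
    ⟨_, fun _ => rfl⟩
  have hw0 : ∀ γ, 0 ≤ w γ := by
    intro γ
    rw [hw]
    split_ifs
    · positivity
    · exact le_rfl
  -- one term
  have hterm : ∀ γ : S.Gk, S.orbitOf γ ∉ E →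
      ∫⁻ p, ‖f ((p.1 : G)⁻¹ * γ * (p.2 : G))‖ₑ ∂((S.μT.restrict S.DT).prod (S.μT'.restrict S.DT'))
        ≤ ENNReal.ofReal (w γ) := by
    intro γ hγ
    rw [hw]
    by_cases hrel : ∃ t ∈ S.DT, ∃ t' ∈ S.DT', f ((t : G)⁻¹ * γ * (t' : G)) ≠ 0
    · rw [if_pos hrel, ENNReal.ofReal_mul (by positivity)]
      exact (lintegral_norm_le_of_support S f γ (hAmeas γ hγ) (hsuppA γ hγ) (hdecay γ hγ)).trans
        (mul_le_mul_right (hAv γ hγ) _)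
    · rw [if_neg hrel, ENNReal.ofReal_zero]
      have hzero : ∀ t ∈ S.DT, ∀ t' ∈ S.DT', ‖f ((t : G)⁻¹ * γ * (t' : G))‖ ≤ 0 := by
        intro t ht t' ht'
        by_contra hne
        exact hrel ⟨t, ht, t', ht', fun h0 => hne (by rw [h0, norm_zero])⟩
      have h := lintegral_norm_le_of_support S f γ (A := ∅) MeasurableSet.empty
        (fun t ht t' ht' hne => absurd (norm_eq_zero.1 (le_antisymm (hzero t ht t' ht') (norm_nonneg _))) hne)
        hzero
      simpa using h
  -- the sum of the weights over the rational points off the fibre, by the threshold layer-cake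
  have hsum : ∀ t : Finset {γ : S.Gk // S.orbitOf γ ∈ (E : Set S.Orbit)ᶜ}, ∑ γ ∈ t, w γ.1 ≤
      v * (C * (C' * Real.exp α * Real.exp (-((β - α) * R)) * (1 - Real.exp (α - β))⁻¹)) := by
    intro t
    -- the relevant members of `t`, as rational points
    obtain ⟨t', ht'⟩ : ∃ t' : Finset S.Gk, ∀ γ, γ ∈ t' ↔ ∃ γ' ∈ t, γ'.1 = γ ∧
        (∃ u ∈ S.DT, ∃ u' ∈ S.DT', f ((u : G)⁻¹ * γ * (u' : G)) ≠ 0) := by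
      refine ⟨(t.filter fun γ' => ∃ u ∈ S.DT, ∃ u' ∈ S.DT', f ((u : G)⁻¹ * γ'.1 * (u' : G)) ≠ 0).map
        (Function.Embedding.subtype _), fun γ => ?_⟩
      simp only [Finset.mem_map, Finset.mem_filter, Function.Embedding.coe_subtype]
      constructor
      · rintro ⟨γ', ⟨hγ't, hrel⟩, rfl⟩
        exact ⟨γ', hγ't, rfl, hrel⟩
      · rintro ⟨γ', hγ't, rfl, hrel⟩
        exact ⟨γ', ⟨hγ't, hrel⟩, rfl⟩
    have hsplit : ∑ γ ∈ t, w γ.1 = ∑ γ ∈ t', C * Real.exp (-(β * d γ)) * v := by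
      have hinj : ∀ γ ∈ t, ∀ γ' ∈ t, (γ : S.Gk) = γ' → γ = γ' := fun γ _ γ' _ h => Subtype.ext h
      rw [← Finset.sum_filter_add_sum_filter_not t
        (fun γ' => ∃ u ∈ S.DT, ∃ u' ∈ S.DT', f ((u : G)⁻¹ * γ'.1 * (u' : G)) ≠ 0)]
      have h0 : ∑ γ ∈ t.filter (fun γ' => ¬ ∃ u ∈ S.DT, ∃ u' ∈ S.DT', f ((u : G)⁻¹ * γ'.1 * (u' : G)) ≠ 0),
          w γ.1 = 0 := by
        refine Finset.sum_eq_zero fun γ hγ => ?_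
        rw [Finset.mem_filter] at hγ
        rw [hw, if_neg hγ.2]
      rw [h0, add_zero]
      have hmap : t' = (t.filter fun γ' => ∃ u ∈ S.DT, ∃ u' ∈ S.DT', f ((u : G)⁻¹ * γ'.1 * (u' : G)) ≠ 0).map
          (Function.Embedding.subtype _) := by
        ext γ
        rw [ht']
        simp only [Finset.mem_map, Finset.mem_filter, Function.Embedding.coe_subtype]
        constructor
        · rintro ⟨γ', hγ't, rfl, hrel⟩
          exact ⟨γ', ⟨hγ't, hrel⟩, rfl⟩
        · rintro ⟨γ', ⟨hγ't, hrel⟩, rfl⟩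
          exact ⟨γ', hγ't, rfl, hrel⟩
      rw [hmap, Finset.sum_map]
      refine Finset.sum_congr rfl fun γ hγ => ?_
      rw [Finset.mem_filter] at hγ
      rw [hw, if_pos hγ.2]
      rfl
    have hthr : ∀ γ ∈ t', R ≤ d γ := by
      intro γ hγ
      obtain ⟨γ', -, rfl, hrel⟩ := (ht' γ).1 hγ
      exact hR γ'.1 γ'.2 hrel
    have hcnt : ∀ T : ℝ, ∃ s : Finset S.Gk, (∀ γ ∈ t', d γ ≤ T → γ ∈ s) ∧
        (s.card : ℝ) ≤ C' * Real.exp (α * T) := by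
      intro T
      obtain ⟨s, hs, hcard⟩ := hcount T
      refine ⟨s, fun γ hγ hdT => ?_, hcard⟩
      obtain ⟨γ', -, rfl, hrel⟩ := (ht' γ).1 hγ
      exact hs _ (hQ _ γ'.2 hrel) hdT
    have hlc := sum_exp_le_of_count_threshold d hαβ hβ hC' t' hthr hcnt
    calc ∑ γ ∈ t, w γ.1 = ∑ γ ∈ t', C * Real.exp (-(β * d γ)) * v := hsplit
      _ = C * v * ∑ γ ∈ t', Real.exp (-(β * d γ)) := by
          rw [Finset.mul_sum]
          refine Finset.sum_congr rfl fun γ _ => ?_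
          ring
      _ ≤ C * v * (C' * Real.exp α * Real.exp (-((β - α) * R)) * (1 - Real.exp (α - β))⁻¹) :=
          mul_le_mul_of_nonneg_left hlc (by positivity)
      _ = v * (C * (C' * Real.exp α * Real.exp (-((β - α) * R)) * (1 - Real.exp (α - β))⁻¹)) := by ring
  have hwsum : Summable fun γ : {γ : S.Gk // S.orbitOf γ ∈ (E : Set S.Orbit)ᶜ} => w γ.1 :=
    summable_of_sum_le (fun γ => hw0 γ.1) hsum
  have htsum : ∑' γ : {γ : S.Gk // S.orbitOf γ ∈ (E : Set S.Orbit)ᶜ}, w γ.1 ≤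
      v * (C * (C' * Real.exp α * Real.exp (-((β - α) * R)) * (1 - Real.exp (α - β))⁻¹)) :=
    Real.tsum_le_of_sum_le (fun γ => hw0 γ.1) hsum
  -- assemble in `ℝ≥0∞`
  have h1 := enorm_J_sub_sum_le_tsum_lintegral S hf hP hχ hχ' E
  have h2a : ∑' γ : {γ : S.Gk // S.orbitOf γ ∈ (E : Set S.Orbit)ᶜ},
      ∫⁻ p, ‖f ((p.1 : G)⁻¹ * γ.1 * (p.2 : G))‖ₑ ∂((S.μT.restrict S.DT).prod (S.μT'.restrict S.DT')) ≤
      ∑' γ : {γ : S.Gk // S.orbitOf γ ∈ (E : Set S.Orbit)ᶜ}, ENNReal.ofReal (w γ.1) :=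
    ENNReal.tsum_le_tsum fun γ => hterm γ.1 γ.2
  have h2b : ∑' γ : {γ : S.Gk // S.orbitOf γ ∈ (E : Set S.Orbit)ᶜ}, ENNReal.ofReal (w γ.1) =
      ENNReal.ofReal (∑' γ : {γ : S.Gk // S.orbitOf γ ∈ (E : Set S.Orbit)ᶜ}, w γ.1) :=
    (ENNReal.ofReal_tsum_of_nonneg (fun γ : {γ : S.Gk // S.orbitOf γ ∈ (E : Set S.Orbit)ᶜ} => hw0 γ.1) hwsum).symm
  have h2 : ‖S.J χ χ' f - ∑ o ∈ E, S.orbital χ χ' o f‖ₑ ≤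
      ENNReal.ofReal (v * (C * (C' * Real.exp α * Real.exp (-((β - α) * R)) * (1 - Real.exp (α - β))⁻¹))) :=
    h1.trans (h2a.trans (h2b.le.trans (ENNReal.ofReal_le_ofReal htsum)))
  have hr1 : Real.exp (α - β) < 1 := by
    rw [Real.exp_lt_one_iff]
    linarith
  have hinv : 0 ≤ (1 - Real.exp (α - β))⁻¹ := inv_nonneg.2 (by linarith)
  have hK0 : 0 ≤ v * (C * (C' * Real.exp α * Real.exp (-((β - α) * R)) * (1 - Real.exp (α - β))⁻¹)) :=
    mul_nonneg hv (mul_nonneg hC (mul_nonneg (mul_nonneg (mul_nonneg hC' (Real.exp_pos _).le)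
      (Real.exp_pos _).le) hinv))
  rw [← toReal_enorm (S.J χ χ' f - ∑ o ∈ E, S.orbital χ χ' o f)]
  exact ENNReal.toReal_le_of_le_ofReal hK0 h2

/-- **THE LEVEL-MEASURE ASSEMBLY** (lead (R-30) S15136, crit-1 Entry 129): for a level family `f N` with the decay at
the rational point uniform in the level, level supports `A N γ` of product measure `≤ v N` (C-L4-SUPPMEAS), the count
of rate `α < β` on the `N`-free region `Q` of the relevant rational points, the threshold `g N → ∞` off the fibre `E`
(the coset sparsity off the fibre), and the main term `m · v N ≤ ‖∑_{o ∈ E} O_o(f N)‖` (`v N = c · suppMeasure N γ₀`,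
the unit of record (R-32); `0 < v N`): the fibre sum dominates the remainder from some level on —
`FibreDominatedFrom S χ χ' E f` unfolded.  The level measure `v N` cancels; the margin `β − α` is spent once, on the
rational points.  The tail-side binders `hdecay` / `hAmeas` / `hsuppA` / `hAv` / `hQ` are asked on the rational
points OFF `E` only (crit-1 S15161 (1)). -/
theorem exists_fibreDominated_of_level_decay_count (f : ℕ → G → ℂ) (hf : ∀ N, Continuous (f N))
    (hP : ∀ N, L1Class.PoincareSummable S (f N)) (d : S.Gk → ℝ) {C α β : ℝ} (hC : 0 ≤ C) (hαβ : α < β)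
    (hβ : 0 ≤ β) {χ : S.T → ℂ} (hχ : S.IsCharacter χ) {χ' : S.T' → ℂ} (hχ' : S.IsCharacter' χ')
    (E : Finset S.Orbit)
    (hdecay : ∀ N (γ : S.Gk), S.orbitOf γ ∉ E → ∀ t ∈ S.DT, ∀ t' ∈ S.DT',
      ‖f N ((t : G)⁻¹ * γ * (t' : G))‖ ≤ C * Real.exp (-(β * d γ)))
    (A : ℕ → S.Gk → Set (S.T × S.T')) (hAmeas : ∀ N γ, S.orbitOf γ ∉ E → MeasurableSet (A N γ))
    (hsuppA : ∀ N (γ : S.Gk), S.orbitOf γ ∉ E → ∀ t ∈ S.DT, ∀ t' ∈ S.DT',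
      f N ((t : G)⁻¹ * γ * (t' : G)) ≠ 0 → (t, t') ∈ A N γ)
    (v : ℕ → ℝ) (hv : ∀ N, 0 < v N)
    (hAv : ∀ N γ, S.orbitOf γ ∉ E →
      ((S.μT.restrict S.DT).prod (S.μT'.restrict S.DT')) (A N γ) ≤ ENNReal.ofReal (v N))
    (Q : S.Gk → Prop)
    (hQ : ∀ N (γ : S.Gk), S.orbitOf γ ∉ E →
      (∃ t ∈ S.DT, ∃ t' ∈ S.DT', f N ((t : G)⁻¹ * γ * (t' : G)) ≠ 0) → Q γ)
    (hcount : ∃ C' : ℝ, 0 ≤ C' ∧ ∀ T : ℝ, ∃ s : Finset S.Gk, (∀ γ, Q γ → d γ ≤ T → γ ∈ s) ∧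
      (s.card : ℝ) ≤ C' * Real.exp (α * T))
    (g : ℕ → ℝ) (hg : Tendsto g atTop atTop)
    (hR : ∀ N (γ : S.Gk), S.orbitOf γ ∉ E →
      (∃ t ∈ S.DT, ∃ t' ∈ S.DT', f N ((t : G)⁻¹ * γ * (t' : G)) ≠ 0) → g N ≤ d γ)
    (hmain : ∃ m : ℝ, 0 < m ∧ ∃ N₁ : ℕ, ∀ N ≥ N₁, m * v N ≤ ‖∑ o ∈ E, S.orbital χ χ' o (f N)‖) :
    ∃ N₀ : ℕ, ∀ N ≥ N₀, ‖S.J χ χ' (f N) - ∑ o ∈ E, S.orbital χ χ' o (f N)‖ <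
      ‖∑ o ∈ E, S.orbital χ χ' o (f N)‖ := by
  obtain ⟨C', hC'0, hcnt⟩ := hcount
  obtain ⟨m, hm, N₁, hN₁⟩ := hmain
  set K : ℝ := C * (C' * Real.exp α * (1 - Real.exp (α - β))⁻¹) with hK
  have htail : ∀ N, ‖S.J χ χ' (f N) - ∑ o ∈ E, S.orbital χ χ' o (f N)‖ ≤
      v N * (K * Real.exp (-((β - α) * g N))) := by
    intro N
    have h := norm_J_sub_sum_le_level S (hf N) (hP N) d hC hαβ hβ hC'0 (hv N).le hχ hχ' E (hdecay N) (A N)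
      (hAmeas N) (hsuppA N) (hAv N) Q (hQ N) hcnt (hR N)
    refine h.trans (le_of_eq ?_)
    rw [hK]
    ring
  obtain ⟨N₂, hN₂⟩ := exists_forall_exp_lt K (sub_pos.2 hαβ) g hg hm
  refine ⟨max N₁ N₂, fun N hN => ?_⟩
  calc ‖S.J χ χ' (f N) - ∑ o ∈ E, S.orbital χ χ' o (f N)‖ ≤ v N * (K * Real.exp (-((β - α) * g N))) := htail N
    _ < v N * m := mul_lt_mul_of_pos_left (hN₂ N (le_trans (le_max_right _ _) hN)) (hv N)
    _ = m * v N := mul_comm _ _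
    _ ≤ ‖∑ o ∈ E, S.orbital χ χ' o (f N)‖ := hN₁ N (le_trans (le_max_left _ _) hN)

/-- **`J(f N) ≠ 0` from some level on**, in the level-measure form. -/
theorem exists_J_ne_zero_of_level_decay_count (f : ℕ → G → ℂ) (hf : ∀ N, Continuous (f N))
    (hP : ∀ N, L1Class.PoincareSummable S (f N)) (d : S.Gk → ℝ) {C α β : ℝ} (hC : 0 ≤ C) (hαβ : α < β)
    (hβ : 0 ≤ β) {χ : S.T → ℂ} (hχ : S.IsCharacter χ) {χ' : S.T' → ℂ} (hχ' : S.IsCharacter' χ')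
    (E : Finset S.Orbit)
    (hdecay : ∀ N (γ : S.Gk), S.orbitOf γ ∉ E → ∀ t ∈ S.DT, ∀ t' ∈ S.DT',
      ‖f N ((t : G)⁻¹ * γ * (t' : G))‖ ≤ C * Real.exp (-(β * d γ)))
    (A : ℕ → S.Gk → Set (S.T × S.T')) (hAmeas : ∀ N γ, S.orbitOf γ ∉ E → MeasurableSet (A N γ))
    (hsuppA : ∀ N (γ : S.Gk), S.orbitOf γ ∉ E → ∀ t ∈ S.DT, ∀ t' ∈ S.DT',
      f N ((t : G)⁻¹ * γ * (t' : G)) ≠ 0 → (t, t') ∈ A N γ)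
    (v : ℕ → ℝ) (hv : ∀ N, 0 < v N)
    (hAv : ∀ N γ, S.orbitOf γ ∉ E →
      ((S.μT.restrict S.DT).prod (S.μT'.restrict S.DT')) (A N γ) ≤ ENNReal.ofReal (v N))
    (Q : S.Gk → Prop)
    (hQ : ∀ N (γ : S.Gk), S.orbitOf γ ∉ E →
      (∃ t ∈ S.DT, ∃ t' ∈ S.DT', f N ((t : G)⁻¹ * γ * (t' : G)) ≠ 0) → Q γ)
    (hcount : ∃ C' : ℝ, 0 ≤ C' ∧ ∀ T : ℝ, ∃ s : Finset S.Gk, (∀ γ, Q γ → d γ ≤ T → γ ∈ s) ∧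
      (s.card : ℝ) ≤ C' * Real.exp (α * T))
    (g : ℕ → ℝ) (hg : Tendsto g atTop atTop)
    (hR : ∀ N (γ : S.Gk), S.orbitOf γ ∉ E →
      (∃ t ∈ S.DT, ∃ t' ∈ S.DT', f N ((t : G)⁻¹ * γ * (t' : G)) ≠ 0) → g N ≤ d γ)
    (hmain : ∃ m : ℝ, 0 < m ∧ ∃ N₁ : ℕ, ∀ N ≥ N₁, m * v N ≤ ‖∑ o ∈ E, S.orbital χ χ' o (f N)‖) :
    ∃ N₀ : ℕ, ∀ N ≥ N₀, S.J χ χ' (f N) ≠ 0 := by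
  obtain ⟨N₀, hN₀⟩ := exists_fibreDominated_of_level_decay_count S f hf hP d hC hαβ hβ hχ hχ' E hdecay A hAmeas
    hsuppA v hv hAv Q hQ hcount g hg hR hmain
  exact ⟨N₀, fun N hN => ne_zero_of_norm_sub_lt (hN₀ N hN)⟩

end Summit.Ventures.HodgeRepro.Tier4.Line4

end
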